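import Mathlib.NumberTheory.Cyclotomic.PrimitiveRoots
import Mathlib.NumberTheory.NumberField.Basic
import HarnessLib

/-!
# The `p`-part of the order of a root of unity in a number field is bounded by the degree

Topic `NumberTheory/NumberFields`; namespace `Literature.NumberTheory.NumberFields`. THEOREMS ONLY.

A number field `F` containing a primitive `n`-th root of unity contains `ℚ(ζ_n)`, so `φ(n) ∣ [F : ℚ]`
(the cyclotomic polynomial `Φ_n` is irreducible over `ℚ`; tower law). Consequently the `p`-power part
`p^c ∥ n` of the order of ANY root of unity `ζ ∈ F` satisfies `p^{c-1}(p-1) = φ(p^c) ≤ φ(n) ≤ [F : ℚ]`, so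
`[F : ℚ] < (p-1)·p^N` forces `c ≤ N`: **`ζ^{M·p^N} = 1` with `M` prime to `p`** — the shape consumed by
Kummer-theoretic arguments that kill the class of a root of unity by a bounded power of `p` (cell
`bsd-print-cf2`, `TwistedZeta.prime_pow_nsmul_eq_zero_of_isTwistedKummerClass_of_pow_eq_one`, input (G0)/P5
of the elliptic-units ⊆ zeta-span lane: along a tower of `2`-power degree `4^m·d` the bound is linear in `m`).

* `totient_orderOf_dvd_finrank_rat` — `φ(ord ζ) ∣ [F : ℚ]` for `ζ` of finite order (also in the tree under the
  Hodge-structures lane, `HodgeStructureK3TypeEndomorphismOrders`, as `NumberField.totient_orderOf_dvd_finrank`;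
  re-proved here in 6 lines to keep the number-field import light — conclusion stated with `Module.finrank ℚ F` on
  the right of `∣` exactly as there, so consumers may use either);
* ★ `exists_coprime_and_pow_mul_prime_pow_eq_one_of_finrank_lt` — `[F : ℚ] < (p-1)·p^N` ⟹
  `∃ M, M.Coprime p ∧ ζ ^ (M * p ^ N) = 1`;
* `exists_coprime_and_pow_mul_two_pow_eq_one_of_finrank_lt` — the `p = 2` reading `[F : ℚ] < 2^N`.

## References

* [Washington1997] L. C. Washington, *Introduction to Cyclotomic Fields*, 2nd ed., GTM 83, Thm. 2.5 (`[ℚ(ζ_n):ℚ] =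
  φ(n)`), Prop. 2.3, and Ex. 2.3 (roots of unity in a number field).
* [NeukirchANT1999] J. Neukirch, *Algebraic Number Theory*, Ch. I §10 Prop. (10.2).
-/

namespace Literature.NumberTheory.NumberFields

open Polynomial IntermediateField

variable {F : Type*} [Field F] [NumberField F]

/-- **`φ(ord ζ) ∣ [F : ℚ]`** for an element `ζ` of finite order of a number field `F`: `ℚ(ζ) ⊆ F` and
`[ℚ(ζ) : ℚ] = deg Φ_{ord ζ} = φ(ord ζ)` (irreducibility of cyclotomic polynomials over `ℚ`).
[cite: Washington1997, Thm. 2.5 and Ex. 2.3] -/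
private theorem totient_orderOf_dvd_finrank_rat' {ζ : F} (hζ : IsOfFinOrder ζ) :
    Nat.totient (orderOf ζ) ∣ Module.finrank ℚ F := by
  have hm : 0 < orderOf ζ := hζ.orderOf_pos
  have hprim : IsPrimitiveRoot ζ (orderOf ζ) := IsPrimitiveRoot.orderOf ζ
  haveI : NeZero ((orderOf ζ : ℕ) : ℚ) := ⟨Nat.cast_ne_zero.2 hm.ne'⟩
  have hmin : minpoly ℚ ζ = cyclotomic (orderOf ζ) ℚ :=
    (hprim.minpoly_eq_cyclotomic_of_irreducible (cyclotomic.irreducible_rat hm)).symm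
  have hint : IsIntegral ℚ ζ := Algebra.IsIntegral.isIntegral ζ
  have h := minpoly.degree_dvd hint (L := F)
  rwa [hmin, natDegree_cyclotomic] at h

/-- ★ **The `p`-part of the order of a root of unity is bounded by the degree**: if `[F : ℚ] < (p-1)·p^N`
then every `ζ ∈ F` of finite order satisfies `ζ^{M p^N} = 1` for some `M` prime to `p` (write `ord ζ = p^c M`,
`p ∤ M`; `φ(p^c) ∣ φ(ord ζ) ∣ [F:ℚ]` forces `c ≤ N`). [cite: Washington1997, Thm. 2.5 and Ex. 2.3] -/
theorem exists_coprime_and_pow_mul_prime_pow_eq_one_of_finrank_lt {p : ℕ} (hp : p.Prime) {N : ℕ}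
    (hF : Module.finrank ℚ F < (p - 1) * p ^ N) {ζ : F} (hζ : IsOfFinOrder ζ) :
    ∃ M : ℕ, M.Coprime p ∧ ζ ^ (M * p ^ N) = 1 := by
  have hn : 0 < orderOf ζ := hζ.orderOf_pos
  obtain ⟨c, M, hpM, hcM⟩ := Nat.exists_eq_pow_mul_and_not_dvd hn.ne' p hp.ne_one
  have hMcop : M.Coprime p := (Nat.Prime.coprime_iff_not_dvd hp).mpr hpM |>.symm
  have hM0 : 0 < M := Nat.pos_of_ne_zero (by rintro rfl; simp at hpM)
  -- `φ(p^c) ≤ φ(ord ζ) ≤ [F : ℚ] < (p-1) p^N`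
  have hdvd := totient_orderOf_dvd_finrank_rat' hζ
  have hle : Nat.totient (p ^ c) ≤ Module.finrank ℚ F := by
    refine le_trans ?_ (Nat.le_of_dvd Module.finrank_pos hdvd)
    rw [hcM, Nat.totient_mul ((Nat.Coprime.pow_left c hMcop.symm))]
    exact Nat.le_mul_of_pos_right _ (Nat.totient_pos.mpr hM0)
  have hcN : c ≤ N := by
    rcases Nat.eq_zero_or_pos c with rfl | hc
    · exact Nat.zero_le _
    · rw [Nat.totient_prime_pow hp hc] at hle
      have h1 : p ^ (c - 1) * (p - 1) < p ^ N * (p - 1) := by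
        calc p ^ (c - 1) * (p - 1) ≤ Module.finrank ℚ F := hle
          _ < (p - 1) * p ^ N := hF
          _ = p ^ N * (p - 1) := mul_comm _ _
      have h2 : p ^ (c - 1) < p ^ N := lt_of_mul_lt_mul_right h1 (Nat.zero_le _)
      have h3 : c - 1 < N := (Nat.pow_lt_pow_iff_right hp.one_lt).mp h2
      omega
  refine ⟨M, hMcop, ?_⟩
  obtain ⟨d, hd⟩ := Nat.exists_eq_add_of_le hcN
  rw [hd, pow_add, ← mul_assoc, mul_comm M, ← hcM, pow_mul, pow_orderOf_eq_one, one_pow]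

/-- **The `p = 2` reading**: `[F : ℚ] < 2^N` ⟹ every root of unity `ζ ∈ F` satisfies `ζ^{M·2^N} = 1` with `M` odd
(e.g. `F = K₀·K̃_m` of degree `2·[K₀:K]·4^m` over `ℚ` for an imaginary quadratic `K`: `N = 2m + 3` for `[K₀:K] ≤ 2`).
[cite: Washington1997, Thm. 2.5 and Ex. 2.3] -/
theorem exists_coprime_and_pow_mul_two_pow_eq_one_of_finrank_lt {N : ℕ} (hF : Module.finrank ℚ F < 2 ^ N)
    {ζ : F} (hζ : IsOfFinOrder ζ) : ∃ M : ℕ, M.Coprime 2 ∧ ζ ^ (M * 2 ^ N) = 1 :=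
  exists_coprime_and_pow_mul_prime_pow_eq_one_of_finrank_lt Nat.prime_two (by simpa using hF) hζ

end Literature.NumberTheory.NumberFields
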